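/-
Copyright: statement-level skeleton of a published paper (lit-balaban cell, Phase-2 proof seat p13, gen 8). No proof
claims beyond what the kernel checks below.
-/
import Literature.MathematicalPhysics.QuantumFieldTheory.BalabanImbrieJaffe1984to88.BIJ88Ineq579First
import Literature.MathematicalPhysics.QuantumFieldTheory.BalabanImbrieJaffe1984to88.BIJ88TraceLog574

/-!
# `BalabanImbrieJaffe1984to88.BIJ88Eq5713Localized` — T. Bałaban, J. Imbrie, A. Jaffe, *Effective action and cluster
properties of the abelian Higgs model*, Commun. Math. Phys. **114** (1988) 257–315 [BalabanImbrieJaffe1988]: Sect. 5.7,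
p. 295 — the `Σ_X`-STRUCTURE OF THE EXPONENT IN THE SUMMARY **(5.7.13)**, *"Π_{j=0}^{k−1} Z^{(j)}_{Λ₁₀^{(j)}}(u_{k+1}ũ̃) =
Π_{j=0}^{k−1} Z^{(j)}_{Λ₁₀^{(j)}}(u_{k+1}) exp[−Q^{(k)}(u_{k+1},θ_kH_{k,loc}A^{(k)}) − Σ_X W₂^{(k)}(X)]"*, DERIVED at the stage reached by
(5.7.3)–(5.7.4) and the localization (5.7.9): the product over `j` of p02's `BIJ88TraceLog574.prod_Z49_eq574` with every exponent
regrouped by p13's `BIJ88Ineq579First.tsum_trace_terms_eq`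

statement-level skeleton of published theorems with citation tags; proofs where landed; nothing here is a claim about the Yang–Mills mass gap

PDF held: `paper:balaban1988-cmp114-bij-abelian-higgs-effective-action` (journal page = PDF page + 256); p. 295 [PDF 39] read as
an IMAGE (CCITT render `pages/original-p039-x2.png` of the p02 seat).

CITATION HEADER (lean-in-tree rule).  Part of the lit-balaban TYPED SKELETON (HOME `run/shared/lean/pub/lit-balaban/`): row
**C2.Eq5.7.13-5.7.15** of `HOME/lit-balaban-r16/ROWS-C2-part2.md`, member (5.7.13) (so far: product structure at the (4.9) level
`BIJ88TraceLog574.prod_Z49_eq574`, p02 g4; main-term shape `BIJ88PertQ5715.eq5713_main`, p02 g6; (5.7.14) = p36's knitting); unit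
`lit-balaban-p13` (gen 8), owner r16, referee ref-5.  Built BY NAME on p02's `prod_Z49_eq574` (its hypotheses verbatim) and p13's
`tsum_trace_terms_eq`; nothing restated.

**What the paper prints (p. 295 [PDF 39], verbatim).**  *"We can summarize the results of this section as follows:
Π_{j=0}^{k−1} Z^{(j)}_{Λ^{(j)}_{10}}(u_{k+1}ũ̃) = Π_{j=0}^{k−1} Z^{(j)}_{Λ^{(j)}_{10}}(u_{k+1}) exp[−Q^{(k)}(u_{k+1}, θ_kH_{k,loc}A^{(k)}) −
Σ_X W^{(k)}_2(X)], (5.7.13) where X is a connected union of r(e_k)-cubes in T^{(k)}_1, W^{(k)}_2(X) = Σ_{j=0}^k W^{(j)′}(X) + … +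
W^{(j)(vi)}(X)"*; p. 290: *"Terms of higher order … are grouped into an expansion Σ_X −W^{(j)}(X)"* (the sign convention of the
localized pieces).

**What is kernel-checked (model instance; zero `sorry`, theorems only, no new definitions or facts).**  With, for every step `j` in a
finite set, the (5.7.2)/(5.7.3) data of p02's file (`C_j = S_j²`, `C_j⁻¹ = (S_j⁻¹)²`, both quadratic forms positive definite,
`‖S_jW_jS_j‖ < 1`) for the EXPANDED operators `C_j = Σ_a C_{j,a}`, `W_j = Σ_b W_{j,b}` (letter families with cube supports, a selection
`S_j` keeping every word of length `> n̄`, summable `W′_j(X)` series — e.g. by `BIJ88Ineq579First.summable_Wprime`):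
**`prod_Z49_eq5713_localized`** —
  `Π_j Z_j(C_j⁻¹ − W_j) = (Π_j Z_j(C_j⁻¹)) · exp[ Σ_j LOW_j + Σ_X Σ_j W′_j(X) ]`,
`LOW_j = Σ_{l ≤ n̄} (1/2l) Σ_X wlen l (¬S_j) X` the separated *"terms of order ≤ n̄ in e_j"* — i.e. the (5.7.13) SHAPE with
`−Q^{(k)} ↤ Σ_j LOW_j` (what the resummation (5.7.10)–(5.7.12), (5.7.15) turns into `−Q^{(k)}`; NOT performed here, cf. p02's
`BIJ88PertQ5715`) and `−W₂^{(k)}(X) ↤ Σ_j W′_j(X)` (only the `W′`-members of `W₂` exist at this stage; the minus sign is the print's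
convention for the localized pieces, p. 290); and `exp_localized_eq_prod` — the exponential of the `X`-sum factorizes over the cube
sets (finite product), the form consumed by the Mayer expansions of Sects. 5.11–5.15.
v1.1 (appended, v1 declarations byte-identical): the print's ORDER SELECTION `S_j l w :⟺ n̄ + 1 ≤ Σ_i deg_j (w i).2` —
`orderSel_of_le`, `not_orderSel_iff`, **`prod_Z49_eq5713_order`** (the hypothesis `hSel` discharged).
HONEST SCOPE: all steps `j` share one site type (as in `prod_Z49_eq574`); the letters, supports and smallness are inputs; nothing of
(5.7.14)'s bound, of `Q^{(k)}`, or of the later replacements `W″…W^{(vi)}` is touched.  Axioms standard.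
-/

namespace Literature.MathematicalPhysics.QuantumFieldTheory.BalabanImbrieJaffe1984to88.BIJ88Eq5713Localized

open Finset
open BIJ88TraceTerms579 BIJ88Ineq579First
open BIJ88Normalization46 (Z49)
open BIJ88TraceLog574 (prod_Z49_eq574)
open scoped Matrix Matrix.Norms.Operator

variable {T ι A B J : Type*} [Fintype T] [DecidableEq T] [Fintype ι] [DecidableEq ι]
  [Fintype A] [DecidableEq A] [Fintype B] [DecidableEq B]

omit [DecidableEq A] [DecidableEq B] in
/-- **(5.7.13), THE `Σ_X`-STRUCTURE OF THE EXPONENT** — for finitely many steps `j ∈ s` with p02's (5.7.3)/(5.7.4) data for the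
expanded operators `C_j = Σ_a C_{j,a}`, `W_j = Σ_b W_{j,b}` and p13's localization of each exponent:
`Π_j Z_j(C_j⁻¹ − W_j) = (Π_j Z_j(C_j⁻¹)) · exp[Σ_j LOW_j + Σ_X Σ_j W′_j(X)]` — the printed
`Π Z(u_{k+1}ũ̃) = Π Z(u_{k+1}) exp[−Q^{(k)} − Σ_X W₂^{(k)}(X)]` with `−Q^{(k)} ↤ Σ_j LOW_j` (the separated low-order terms, to be
resummed) and `−W₂^{(k)}(X) ↤ Σ_j W′_j(X)`. [cite: BalabanImbrieJaffe1988, (5.7.13) p.295] -/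
theorem prod_Z49_eq5713_localized (s : Finset J)
    (Cl : J → A → Matrix T T ℝ) (sC : J → A → Finset ι) (Wl : J → B → Matrix T T ℝ) (sW : J → B → Finset ι)
    {Cinv Sq Sinv : J → Matrix T T ℝ} {E N : J → ℝ}
    (h1 : ∀ j ∈ s, Sq j * Sinv j = 1) (h2 : ∀ j ∈ s, Sinv j * Sq j = 1) (hC : ∀ j ∈ s, Sinv j * Sinv j = Cinv j)
    (hSS : ∀ j ∈ s, Sq j * Sq j = ∑ a, Cl j a) (hCinv : ∀ j ∈ s, (Cinv j).PosDef)
    (hT : ∀ j ∈ s, (Cinv j - ∑ b, Wl j b).PosDef) (hW : ∀ j ∈ s, ‖Sq j * (∑ b, Wl j b) * Sq j‖ < 1)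
    (Sel : J → (l : ℕ) → (Fin (l + 1) → A × B) → Prop) [∀ j l, DecidablePred (Sel j l)] (nbar : ℕ)
    (hSel : ∀ j ∈ s, ∀ l, nbar ≤ l → ∀ w, Sel j l w)
    (hsum : ∀ j ∈ s, ∀ X : Finset ι,
      Summable (fun l : ℕ => 1 / (2 * ((l : ℝ) + 1)) * wlen (Cl j) (sC j) (Wl j) (sW j) (l + 1) (Sel j l) X)) :
    ∏ j ∈ s, Z49 (Cinv j - ∑ b, Wl j b) (E j) (N j) =
      (∏ j ∈ s, Z49 (Cinv j) (E j) (N j)) *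
        Real.exp ((∑ j ∈ s, ∑ l ∈ Finset.range nbar, ∑ X : Finset ι,
            1 / (2 * ((l : ℝ) + 1)) * wlen (Cl j) (sC j) (Wl j) (sW j) (l + 1) (fun w => ¬ Sel j l w) X) +
          ∑ X : Finset ι, ∑ j ∈ s, Wprime (Cl j) (sC j) (Wl j) (sW j) (Sel j) X) := by
  rw [prod_Z49_eq574 s (C := fun j => ∑ a, Cl j a) (W := fun j => ∑ b, Wl j b) h1 h2 hC hSS hCinv hT hW]
  congr 2
  rw [Finset.sum_comm (s := Finset.univ) (t := s), ← Finset.sum_add_distrib]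
  refine Finset.sum_congr rfl fun j hj => ?_
  rw [tsum_trace_terms_eq (Cl j) (sC j) (Wl j) (sW j) (Sel j) nbar (hSel j hj) (hsum j hj), add_comm]

omit [DecidableEq A] [DecidableEq B] in
/-- … and the exponential of the `X`-sum FACTORIZES over the cube sets, `exp[Σ_X Σ_j W′_j(X)] = Π_X exp[Σ_j W′_j(X)]` (finite
product) — the form in which `exp[−Σ_X W₂^{(k)}(X)]` enters the Mayer expansions of Sects. 5.11–5.15 (`Π_X (1 + (e^{−W₂(X)} − 1))`).
[cite: BalabanImbrieJaffe1988, (5.7.13) p.295, (5.11.2) p.299] -/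
theorem exp_localized_eq_prod (s : Finset J)
    (Cl : J → A → Matrix T T ℝ) (sC : J → A → Finset ι) (Wl : J → B → Matrix T T ℝ) (sW : J → B → Finset ι)
    (Sel : J → (l : ℕ) → (Fin (l + 1) → A × B) → Prop) [∀ j l, DecidablePred (Sel j l)] :
    Real.exp (∑ X : Finset ι, ∑ j ∈ s, Wprime (Cl j) (sC j) (Wl j) (sW j) (Sel j) X) =
      ∏ X : Finset ι, Real.exp (∑ j ∈ s, Wprime (Cl j) (sC j) (Wl j) (sW j) (Sel j) X) :=
  Real.exp_sum _ _

/-! ## (v1.1) The selection of the print: words of total `e_j`-order `> n̄`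

p. 291: *"In the expansion (5.7.4) we put W^{(j)} = W^{(j,n̄)} + Σ_X W^{(j)}(X). In terms with l ≤ n̄ we separate from
[(1/2l) tr(C W)^l] the terms of order ≤ n̄ in e_j. … In the other terms we insert the expansion for C^{(j)}_{Λ₁₀}(u_{k+1}); they
then take the form Σ_X W^{(j)′}(X)"*.  With every letter `W_b` carrying its `e_j`-order `deg b ≥ 1` (a Taylor coefficient of
`W^{(j,n̄)}` of order `i` has `deg = i`, a localized remainder `W^{(j)}(X) = O(e_j^{n̄+1−α})` has `deg = n̄ + 1`, cf.
`BIJ88Ineq579First.abs_wlen_le_graded`), the print's split is the ORDER SELECTION `S l w :⟺ n̄ + 1 ≤ Σ_i deg (w i).2`: the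
unselected words are exactly those of total order `≤ n̄` (`not_orderSel_iff`), and every word of length `> n̄` is selected
(`orderSel_of_le`) — so the hypothesis `hSel` of `prod_Z49_eq5713_localized` holds automatically (`prod_Z49_eq5713_order`). -/

section OrderSelection

omit [Fintype A] [DecidableEq A] [Fintype B] [DecidableEq B] in
/-- Every word of length `l + 1 > n̄` has total `e_j`-order `≥ n̄ + 1` when each letter has order `≥ 1`: the terms with `l > n̄`
of (5.7.4) are entirely *"other terms"* (no part of order `≤ n̄`). [cite: BalabanImbrieJaffe1988, p.291] -/
theorem orderSel_of_le (deg : B → ℕ) (hdeg : ∀ b, 1 ≤ deg b) {nbar l : ℕ} (h : nbar ≤ l) (w : Fin (l + 1) → A × B) :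
    nbar + 1 ≤ ∑ i, deg (w i).2 :=
  calc nbar + 1 ≤ l + 1 := Nat.succ_le_succ h
    _ = ∑ _i : Fin (l + 1), 1 := by simp
    _ ≤ ∑ i, deg (w i).2 := Finset.sum_le_sum fun i _ => hdeg (w i).2

omit [Fintype A] [DecidableEq A] [Fintype B] [DecidableEq B] in
/-- The unselected words of the order selection are exactly the words *"of order ≤ n̄ in e_j"*.
[cite: BalabanImbrieJaffe1988, p.291] -/
theorem not_orderSel_iff (deg : B → ℕ) {nbar l : ℕ} (w : Fin (l + 1) → A × B) :
    ¬ (nbar + 1 ≤ ∑ i, deg (w i).2) ↔ ∑ i, deg (w i).2 ≤ nbar :=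
  Nat.not_le.trans Nat.lt_add_one_iff

omit [DecidableEq A] [DecidableEq B] in
/-- **(5.7.13) WITH THE PRINT'S ORDER SELECTION** — `prod_Z49_eq5713_localized` for `S_j l w :⟺ n̄ + 1 ≤ Σ_i deg_j (w i).2`
(its hypothesis `hSel` discharged by `orderSel_of_le`): the low-order part collects exactly the words of total `e_j`-order
`≤ n̄` and length `≤ n̄` (*"the terms of order ≤ n̄ in e_j"*, to be resummed into `Q^{(k)}`), the rest is `Σ_X Σ_j W′_j(X)` with
every `W′_j(X)` of order `≥ n̄ + 1` (and bounded as in (5.7.9) by `BIJ88Ineq579First.abs_Wprime_le_printed`, which also gives the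
summability assumed here, `BIJ88Ineq579First.summable_Wprime`). [cite: BalabanImbrieJaffe1988, (5.7.13) p.295, p.291] -/
theorem prod_Z49_eq5713_order (s : Finset J)
    (Cl : J → A → Matrix T T ℝ) (sC : J → A → Finset ι) (Wl : J → B → Matrix T T ℝ) (sW : J → B → Finset ι)
    {Cinv Sq Sinv : J → Matrix T T ℝ} {E N : J → ℝ}
    (h1 : ∀ j ∈ s, Sq j * Sinv j = 1) (h2 : ∀ j ∈ s, Sinv j * Sq j = 1) (hC : ∀ j ∈ s, Sinv j * Sinv j = Cinv j)
    (hSS : ∀ j ∈ s, Sq j * Sq j = ∑ a, Cl j a) (hCinv : ∀ j ∈ s, (Cinv j).PosDef)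
    (hT : ∀ j ∈ s, (Cinv j - ∑ b, Wl j b).PosDef) (hW : ∀ j ∈ s, ‖Sq j * (∑ b, Wl j b) * Sq j‖ < 1)
    (deg : J → B → ℕ) (hdeg : ∀ j b, 1 ≤ deg j b) (nbar : ℕ)
    (hsum : ∀ j ∈ s, ∀ X : Finset ι, Summable (fun l : ℕ => 1 / (2 * ((l : ℝ) + 1)) *
      wlen (Cl j) (sC j) (Wl j) (sW j) (l + 1) (fun w => nbar + 1 ≤ ∑ i, deg j (w i).2) X)) :
    ∏ j ∈ s, Z49 (Cinv j - ∑ b, Wl j b) (E j) (N j) =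
      (∏ j ∈ s, Z49 (Cinv j) (E j) (N j)) *
        Real.exp ((∑ j ∈ s, ∑ l ∈ Finset.range nbar, ∑ X : Finset ι,
            1 / (2 * ((l : ℝ) + 1)) *
              wlen (Cl j) (sC j) (Wl j) (sW j) (l + 1) (fun w => ¬ (nbar + 1 ≤ ∑ i, deg j (w i).2)) X) +
          ∑ X : Finset ι, ∑ j ∈ s, Wprime (Cl j) (sC j) (Wl j) (sW j) (fun _ w => nbar + 1 ≤ ∑ i, deg j (w i).2) X) :=
  prod_Z49_eq5713_localized s Cl sC Wl sW h1 h2 hC hSS hCinv hT hW (fun j _ w => nbar + 1 ≤ ∑ i, deg j (w i).2) nbar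
    (fun j _ _ hl w => orderSel_of_le (deg j) (hdeg j) hl w) hsum

end OrderSelection

end Literature.MathematicalPhysics.QuantumFieldTheory.BalabanImbrieJaffe1984to88.BIJ88Eq5713Localized
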